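import Summits.QuantumFields.YangMills.Theorems.UnitScaleTiltProp7KernelColumnRowDuality
import Summits.QuantumFields.YangMills.Theorems.UnitScaleTiltProp7PcolAllMembers
import HarnessLib

/-!
# Route `UnitScaleTilt`, crux K1 «MinimiserStabilityRegPr» (stmt-QuantumFields-19200), EX rows `norm_G` ∕ `hPcol` (S47 ✓p766895), NORM_G ROAD (★p1 g27 CENSUS #46 row (5)) —
# **(Dg) ⟸ hPcol BY THE CONVERSE COLUMN∕ROW DUALITY**: the sup row of the GRADIENT operator `D_{U₀}R_SG′ᴾ` on site sources — the one displayed letter `hDg` of the (H∇)-KNIT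
# (✓∕⧗`Prop7ChainPotentialHessianRow.hessRow_chain_of_letters`) — IS the EX row `hPcol` (the `ℓ¹` COLUMN of the kernel of `G′ᴾR_SD*_{U₀}`) read the other way, `C_Dg := 8·p139`.

Cell `ym3-torus` (HUMAN RULING D-0037; rung R3 = SU(2) YM₃ on T³ — NOT d = 4, NOT infinite volume, NOT a mass gap, NOT Clay).  Width seat `ym3-torus-px17` (gen 12).
THEOREMS ONLY (0 `def`, 0 `sorry`, default heartbeats); `--supports stmt-QuantumFields-19200 --as helper`; count-neutral.

WHY.  px5's ✓`Prop7KernelColumnRowDuality` proves ROW(`A†`) ⟹ COLUMN(`A`) (and reads `hPcol` from a gradient row).  The (H∇)-KNIT needs the CONVERSE: the sup→sup row of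
`A† = D_{U₀} ∘ R_S ∘ G′ᴾ` (✓`adjoint_GprimeP_RS_DstarL2`) from the column bound of `A = G′ᴾ ∘ R_S ∘ D*_{U₀}` — which is EXACTLY the EX row `hPcol`, already displayed in S47 and supplied
by the px5∕px10∕px12 lineage (✓`Prop7PcolPin.hPcol_pin` → ✓`Prop7PcolMember.hPcol_member_of_lift` → the AllMembers package).  The exchange is the same finite-dimensional duality read
backwards: test `A†g` at `x₀` against the one-point spikes `δ = δ_{x₀} ⊗ e_k`: `c·(A†g)(x₀)_k = ⟪δ, A†g⟫ = ⟪Aδ, g⟫`, `|⟪Aδ, g⟫| ≤ c·Gb·Σ_y ‖(Aδ)(y)‖ ≤ c·Gb·C·‖e_k‖`, then `ℓ² ≤ ℓ¹` over the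
`card m` coordinates.  So (Dg) is NOT a new gradient display: **`norm_G`'s ∇-half ⟸ hPcol** (plus (∇0), (Hess3), `norm_H₁` and the value letters).

WHAT IS PROVED (ns `Summit.QuantumFields.YangMills.Theorems.Prop7GradientRowOfPcol`).
* §1 ★★ `norm_equiv_adjoint_apply_le_of_column` — abstract converse duality: for `A : WL2(X, c; ℂ^m) →ₗ WL2(Y, c; ℂ^m)` with the one-point column bound
  `Σ_y ‖(Aδ)(y)‖ ≤ C·‖δ(x₀)‖`, every `g` with `‖g(y)‖ ≤ Gb` (`0 ≤ Gb`) has `‖(A†g)(x₀)‖ ≤ card(m)·(C·Gb)`.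
* §2 ★★ `column_of_hPcol` — the member's `hPcol` TEXT (route currency, operator norms) ⟹ the torus-currency one-point column bound of `A := G′ᴾ ∘ R_S ∘ D*` with `C := √2·p139`.
* §3 ★★★ `gradRow_RS_GprimeP_of_hPcol` — **(H∇)'s `hDg` TEXT VERBATIM** from the `hPcol` text: `∀ v m, (∀ x, ‖v x‖ ≤ m) → ∀ b, ‖toL2⁻¹(D_{U₀}(R_S(G′ᴾ(toL2S v)))) b‖ ≤ (8·p139)·m`
  (`4 = dim W₂`, `√2·√2` Frobenius∕operator, ✓`adjoint_GprimeP_RS_DstarL2` for `0 ≤ a`).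
* §4 ★★★ `gradRow_RS_GprimeP_allMembers_exists` — THE FAMILY EDITION: §3 ∘ ✓`Prop7PcolAllMembers.hPcol_allMembers_exists` (the S47 supplier of `hPcol`, LANDED) ⟹ `∃ αP CDg : ℕ → ℝ` with
  `0 < αP L`, `0 ≤ CDg L` and, for EVERY member `i : Idx L`, every `0 ≤ a′`, every `U₀ ∈ RegPr (αP L)` under the face's Lift antecedent, the (Dg) text with `CDg L = 8·pP L` — (Dg) is a THEOREM modulo Lift.
HYP-SAT (★★OWNER RULING №42): §1 is pure linear algebra on an ARBITRARY `A`; §2∕§3's only hypothesis is the S47 `hPcol` row text at one member (inhabited: ✓`hPcol_member_of_lift` under `RegPr` +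
Lift + room + margin) and `0 ≤ a`; conclusions are kernel∕sup bounds for the row's own objects — non-vacuous, no `Prop` placeholder.
HONEST SCOPE.  Finite-dimensional duality; nothing of `hPcol`, (L3′b), the (H∇)∕(∇1) letters, `norm_G`, the eight EX print rows, `hThm2S`, EX `stub_existenceMinimalOrbit`, `MinimiserStabilityRegPr`
(19200) or R3 is proved here; the Yang–Mills mass gap is NOT proved.

References: T. Bałaban, CMP **99** (1985) 389–434 [Balaban1985BackgroundPropagators] ((3.8) and (3.11) p.392, (3.21)–(3.25) p.394, Thm 3.1 (3.42) p.397); CMP **102** (1985) 277–309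
[Balaban1985Variational] ((138)–(139) p.299 «`G′RD*` is a bounded operator in the norm `|·|₍₁₎`»).
-/

set_option autoImplicit false

noncomputable section

open scoped BigOperators InnerProductSpace ComplexConjugate Matrix.Norms.L2Operator

namespace Summit.QuantumFields.YangMills.Theorems.Prop7GradientRowOfPcol

open Literature.MathematicalPhysics.QuantumFieldTheory.Balaban1983to89
open Literature.MathematicalPhysics.QuantumFieldTheory.Balaban1983to89.T3ContinuumYM3Torus
open B9Eq311L2Pairing (WL2)
open B11Eq103H1Complex (SiteL2K BondL2K)
open Summit.QuantumFields.YangMills.Theorems.Prop7SectET3Transport (periodsT3 siteEquiv bondEquiv)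
open Summit.QuantumFields.YangMills.Theorems.Prop7SectET3HilbertLetters (W₂ frobEquiv toL2 toL2S DL2 DstarL2 toL2_apply toL2S_apply toL2_symm_apply toL2S_symm_apply)
open Summit.QuantumFields.YangMills.Theorems.Prop7RieszTauFrobNorm (norm_frobEquiv_le norm_frobEquiv_symm_le norm_le_sqrt_two_mul_norm_frobEquiv)
open Summit.QuantumFields.YangMills.Theorems.Prop7SectET3GaugeProjector (RS)
open Summit.QuantumFields.YangMills.Theorems.Prop7SectET3DeltaPiPInv (GprimeP)
open Summit.QuantumFields.YangMills.Theorems.Prop7KernelColumnRowDuality (norm_le_sum_norm_coord adjoint_GprimeP_RS_DstarL2)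
open Summit.QuantumFields.YangMills.Theorems.Prop8Chart (emlIterU)
open B15DeterminingSets (embIter)
open T3SectALandauChart (bgUnits)
open T3PrintedRegularMinimiser (RegPr)
open Summit.QuantumFields.YangMills.Theorems.Prop7PcolAllMembers (hPcol_allMembers_exists)

/-! ## §1 The abstract converse exchange: `ℓ^∞` row of `A†` ≤ `dim` × `ℓ¹` column of `A` -/

section Abstract

variable {X Y m : Type*} [Fintype X] [Fintype Y] [Fintype m] [DecidableEq X] [DecidableEq m] {c : ℝ} [Fact (0 < c)]

/-- ★★ **CONVERSE COLUMN∕ROW DUALITY.**  Let `A : WL2(X, c; ℂ^m) → WL2(Y, c; ℂ^m)` be linear between weighted `L²` spaces with the SAME constant weight `c > 0`, and suppose every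
one-point source has the `ℓ¹` column bound `C`: `Σ_y ‖(Aδ)(y)‖ ≤ C·‖δ(x₀)‖` whenever `δ` vanishes off `x₀`.  Then the Hilbert adjoint has the `ℓ^∞ → ℓ^∞` row bound `card(m)·C`:
`‖(A†g)(x₀)‖ ≤ card(m)·(C·Gb)` whenever `‖g(y)‖ ≤ Gb` for all `y` (`0 ≤ Gb`).  PROOF: `c·((A†g)(x₀))_k = conj⟪A†g, δ_{x₀}⊗e_k⟫`-sized, `⟪A†g, δ⟫ = ⟪g, Aδ⟫`, Cauchy–Schwarz fibrewise,
then `ℓ² ≤ ℓ¹` over the coordinates. [cite: Balaban1985BackgroundPropagators, (3.11) p.392, Thm 3.1 (3.42) p.397] -/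
theorem norm_equiv_adjoint_apply_le_of_column
    (A : WL2 ℂ (fun _ : X => c) (EuclideanSpace ℂ m) →ₗ[ℂ] WL2 ℂ (fun _ : Y => c) (EuclideanSpace ℂ m)) {C : ℝ}
    (hcol : ∀ (δ : WL2 ℂ (fun _ : X => c) (EuclideanSpace ℂ m)) (x₀ : X),
      (∀ x, x ≠ x₀ → WL2.equiv ℂ (fun _ : X => c) (EuclideanSpace ℂ m) δ x = 0) →
        ∑ y, ‖WL2.equiv ℂ (fun _ : Y => c) (EuclideanSpace ℂ m) (A δ) y‖ ≤ C * ‖WL2.equiv ℂ (fun _ : X => c) (EuclideanSpace ℂ m) δ x₀‖)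
    (g : WL2 ℂ (fun _ : Y => c) (EuclideanSpace ℂ m)) {Gb : ℝ} (hGb : 0 ≤ Gb)
    (hg : ∀ y, ‖WL2.equiv ℂ (fun _ : Y => c) (EuclideanSpace ℂ m) g y‖ ≤ Gb) (x₀ : X) :
    ‖WL2.equiv ℂ (fun _ : X => c) (EuclideanSpace ℂ m) (LinearMap.adjoint A g) x₀‖ ≤ Fintype.card m * (C * Gb) := by
  classical
  have hc : 0 < c := Fact.out
  set w := WL2.equiv ℂ (fun _ : X => c) (EuclideanSpace ℂ m) (LinearMap.adjoint A g) x₀ with hw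
  -- per coordinate `k`
  have hk : ∀ k : m, ‖w k‖ ≤ C * Gb := by
    intro k
    -- the one-point spike `δ := δ_{x₀} ⊗ e_k`
    let δ : WL2 ℂ (fun _ : X => c) (EuclideanSpace ℂ m) :=
      (WL2.equiv ℂ (fun _ : X => c) (EuclideanSpace ℂ m)).symm (Pi.single (M := fun _ : X => EuclideanSpace ℂ m) x₀ (EuclideanSpace.single k (1 : ℂ)))
    have hδ : ∀ x, WL2.equiv ℂ (fun _ : X => c) (EuclideanSpace ℂ m) δ x
        = (Pi.single (M := fun _ : X => EuclideanSpace ℂ m) x₀ (EuclideanSpace.single k (1 : ℂ))) x := fun _ => rfl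
    have hδ0 : ∀ x, x ≠ x₀ → WL2.equiv ℂ (fun _ : X => c) (EuclideanSpace ℂ m) δ x = 0 := fun x hx => by
      rw [hδ, Pi.single_eq_of_ne hx]
    have hδx : WL2.equiv ℂ (fun _ : X => c) (EuclideanSpace ℂ m) δ x₀ = EuclideanSpace.single k (1 : ℂ) := by
      rw [hδ, Pi.single_eq_same]
    have hδn : ‖WL2.equiv ℂ (fun _ : X => c) (EuclideanSpace ℂ m) δ x₀‖ = 1 := by
      rw [hδx, PiLp.norm_single, norm_one]
    -- `⟪A†g, δ⟫ = c·conj(w k)`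
    have hleft : ⟪LinearMap.adjoint A g, δ⟫_ℂ = ((c : ℝ) : ℂ) * (starRingEnd ℂ) (w k) := by
      rw [WL2.inner_def, Finset.sum_eq_single x₀]
      · rw [hδx, ← hw, EuclideanSpace.inner_single_right, one_mul]
        rfl
      · intro x _ hx
        rw [hδ0 x hx, inner_zero_right, mul_zero]
      · intro h
        exact absurd (Finset.mem_univ x₀) h
    -- `⟪A†g, δ⟫ = ⟪g, Aδ⟫`, bounded fibrewise by Cauchy–Schwarz and the column letter
    have hright : ‖⟪g, A δ⟫_ℂ‖ ≤ c * (Gb * C) := by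
      rw [WL2.inner_def]
      refine (norm_sum_le _ _).trans ?_
      have hterm : ∀ y, ‖(((fun _ : Y => c) y : ℝ) : ℂ) * ⟪WL2.equiv ℂ (fun _ : Y => c) (EuclideanSpace ℂ m) g y,
          WL2.equiv ℂ (fun _ : Y => c) (EuclideanSpace ℂ m) (A δ) y⟫_ℂ‖
          ≤ c * (Gb * ‖WL2.equiv ℂ (fun _ : Y => c) (EuclideanSpace ℂ m) (A δ) y‖) := by
        intro y
        rw [norm_mul, Complex.norm_real, Real.norm_of_nonneg hc.le]
        refine mul_le_mul_of_nonneg_left ((norm_inner_le_norm _ _).trans ?_) hc.le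
        exact mul_le_mul_of_nonneg_right (hg y) (norm_nonneg _)
      refine (Finset.sum_le_sum fun y _ => hterm y).trans ?_
      rw [← Finset.mul_sum, ← Finset.mul_sum]
      refine mul_le_mul_of_nonneg_left (mul_le_mul_of_nonneg_left ?_ hGb) hc.le
      have hcolδ := hcol δ x₀ hδ0
      rwa [hδn, mul_one] at hcolδ
    have heq : ‖⟪LinearMap.adjoint A g, δ⟫_ℂ‖ = c * ‖w k‖ := by
      rw [hleft, norm_mul, Complex.norm_real, Real.norm_of_nonneg hc.le, Complex.norm_conj]
    have hadj : ⟪LinearMap.adjoint A g, δ⟫_ℂ = ⟪g, A δ⟫_ℂ := LinearMap.adjoint_inner_left A δ g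
    have h1 : c * ‖w k‖ ≤ c * (Gb * C) := by rw [← heq, hadj]; exact hright
    have h2 := le_of_mul_le_mul_left h1 hc
    linarith [h2, mul_comm Gb C]
  calc ‖w‖ ≤ ∑ k, ‖w k‖ := norm_le_sum_norm_coord w
    _ ≤ ∑ _k : m, C * Gb := Finset.sum_le_sum fun k _ => hk k
    _ = Fintype.card m * (C * Gb) := by rw [Finset.sum_const, Finset.card_univ, nsmul_eq_mul]

end Abstract

/-! ## §2 The member's `hPcol` text as a torus-currency column bound -/

section Member

variable (F : T3Family) {n K : ℕ} (h : n ≤ K) (c₀ cB a : ℝ) [Fact (0 < c₀)] [Fact (0 < cB)]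

/-- ★★ **`hPcol` (route currency) ⟹ THE ONE-POINT COLUMN BOUND OF `A := G′ᴾ ∘ R_S ∘ D*` (torus currency), `C := √2·p139`**: a one-point `δ` at `p₀` IS `toL2(δ_{bd} ⊗ E)` with
`bd = bondEquiv⁻¹ p₀`, `E = toL2⁻¹δ bd` (`‖E‖ ≤ ‖δ(p₀)‖_{W₂}`, ✓`norm_frobEquiv_le`); the `W₂` norms of `Aδ` at the lit sites are `≤ √2 ×` the operator norms of `toL2S⁻¹(Aδ)` at the route sites
(✓`norm_le_sqrt_two_mul_norm_frobEquiv`, ✓`toL2S_symm_apply`, re-indexed along `siteEquiv`). [cite: Balaban1985BackgroundPropagators, (3.11) p.392; Balaban1985Variational, (139) p.299] -/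
theorem column_of_hPcol (U₀ : GaugeField (F.P K) 0 (Matrix.specialUnitaryGroup (Fin 2) ℂ)) {p139 : ℝ}
    (hPcol : ∀ (bd : PBond (F.P K) 0) (E : Matrix (Fin 2) (Fin 2) ℂ),
      ∑ x : Site (F.P K) 0, ‖(toL2S F K c₀).symm (GprimeP F n K h c₀ cB a U₀ (RS F n K h c₀ cB U₀ (DstarL2 F n K c₀ U₀ (toL2 F K c₀ (Pi.single bd E))))) x‖ ≤ p139 * ‖E‖)
    (δ : BondL2K ℂ 3 (periodsT3 F K) c₀ W₂) (p₀ : B9SectCLatticeCarrier.Bond 3 (periodsT3 F K))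
    (hδ : ∀ p, p ≠ p₀ → WL2.equiv ℂ _ W₂ δ p = 0) :
    ∑ y, ‖WL2.equiv ℂ _ W₂ ((GprimeP F n K h c₀ cB a U₀ ∘ₗ RS F n K h c₀ cB U₀ ∘ₗ DstarL2 F n K c₀ U₀) δ) y‖
      ≤ (Real.sqrt 2 * p139) * ‖WL2.equiv ℂ _ W₂ δ p₀‖ := by
  classical
  -- `δ = toL2 (δ_bd ⊗ E)`
  set bd : PBond (F.P K) 0 := (bondEquiv F K).symm p₀ with hbd
  set E : Matrix (Fin 2) (Fin 2) ℂ := (toL2 F K c₀).symm δ bd with hE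
  have hX : (toL2 F K c₀).symm δ = Pi.single bd E := by
    funext b
    by_cases hb : b = bd
    · rw [hb, Pi.single_eq_same]
    · have hne : bondEquiv F K b ≠ p₀ := fun e => hb (by rw [hbd, ← e, Equiv.symm_apply_apply])
      rw [Pi.single_eq_of_ne hb, toL2_symm_apply, hδ _ hne, map_zero]
  have hδeq : δ = toL2 F K c₀ (Pi.single bd E) := by
    rw [← hX, LinearEquiv.apply_symm_apply]
  have hEle : ‖E‖ ≤ ‖WL2.equiv ℂ _ W₂ δ p₀‖ := by
    rw [hE, toL2_symm_apply, hbd, Equiv.apply_symm_apply]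
    exact norm_frobEquiv_le _
  -- `0 ≤ p139` (test `hPcol` at `E = 0`... use the bound at our `E` and nonnegativity instead)
  have hsum : ∑ x : Site (F.P K) 0, ‖(toL2S F K c₀).symm ((GprimeP F n K h c₀ cB a U₀ ∘ₗ RS F n K h c₀ cB U₀ ∘ₗ DstarL2 F n K c₀ U₀) δ) x‖ ≤ p139 * ‖E‖ := by
    rw [hδeq, LinearMap.comp_apply, LinearMap.comp_apply]
    exact hPcol bd E
  have hp : 0 ≤ p139 * ‖E‖ := (Finset.sum_nonneg fun x _ => norm_nonneg _).trans hsum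
  by_cases hE0 : E = 0
  · -- the zero spike: both sides vanish
    have hδ0' : δ = 0 := by rw [hδeq, hE0, Pi.single_zero, map_zero]
    rw [hδ0', map_zero]
    simp
  have hEpos : 0 < ‖E‖ := norm_pos_iff.mpr hE0
  have hp0 : 0 ≤ p139 := nonneg_of_mul_nonneg_left hp hEpos
  calc ∑ y, ‖WL2.equiv ℂ _ W₂ ((GprimeP F n K h c₀ cB a U₀ ∘ₗ RS F n K h c₀ cB U₀ ∘ₗ DstarL2 F n K c₀ U₀) δ) y‖
      = ∑ x : Site (F.P K) 0, ‖WL2.equiv ℂ _ W₂ ((GprimeP F n K h c₀ cB a U₀ ∘ₗ RS F n K h c₀ cB U₀ ∘ₗ DstarL2 F n K c₀ U₀) δ) (siteEquiv F K x)‖ :=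
        ((siteEquiv F K).sum_comp (fun y => ‖WL2.equiv ℂ _ W₂ ((GprimeP F n K h c₀ cB a U₀ ∘ₗ RS F n K h c₀ cB U₀ ∘ₗ DstarL2 F n K c₀ U₀) δ) y‖)).symm
    _ ≤ ∑ x : Site (F.P K) 0, Real.sqrt 2 * ‖(toL2S F K c₀).symm ((GprimeP F n K h c₀ cB a U₀ ∘ₗ RS F n K h c₀ cB U₀ ∘ₗ DstarL2 F n K c₀ U₀) δ) x‖ :=
        Finset.sum_le_sum fun x _ => by rw [toL2S_symm_apply]; exact norm_le_sqrt_two_mul_norm_frobEquiv _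
    _ = Real.sqrt 2 * ∑ x : Site (F.P K) 0, ‖(toL2S F K c₀).symm ((GprimeP F n K h c₀ cB a U₀ ∘ₗ RS F n K h c₀ cB U₀ ∘ₗ DstarL2 F n K c₀ U₀) δ) x‖ := by
        rw [Finset.mul_sum]
    _ ≤ Real.sqrt 2 * (p139 * ‖E‖) := mul_le_mul_of_nonneg_left hsum (Real.sqrt_nonneg _)
    _ ≤ Real.sqrt 2 * (p139 * ‖WL2.equiv ℂ _ W₂ δ p₀‖) :=
        mul_le_mul_of_nonneg_left (mul_le_mul_of_nonneg_left hEle hp0) (Real.sqrt_nonneg _)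
    _ = (Real.sqrt 2 * p139) * ‖WL2.equiv ℂ _ W₂ δ p₀‖ := by ring

/-! ## §3 ★★★ (Dg) from `hPcol` -/

/-- ★★★ **(Dg) ⟸ hPcol: THE SUP ROW OF `D_{U₀}R_SG′ᴾ` ON SITE SOURCES FROM THE EX ROW `hPcol`.**  For `0 ≤ a` and the member's `hPcol` text with constant `p139`:
`∀ v m, (∀ x, ‖v x‖ ≤ m) → ∀ b, ‖toL2⁻¹(D_{U₀}(R_S(G′ᴾ_a(toL2S v)))) b‖ ≤ (8·p139)·m` — the (H∇)-KNIT's `hDg` binder TOKEN FOR TOKEN with `C_Dg := 8·p139` (§1 at `A := G′ᴾ∘R_S∘D*`,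
`A† = D∘R_S∘G′ᴾ` ✓`adjoint_GprimeP_RS_DstarL2`, §2, `card(Fin 2 × Fin 2) = 4`, torus∕route `√2` twice). [cite: Balaban1985Variational, (138)–(139) p.299; Balaban1985BackgroundPropagators, (3.8), (3.11) p.392, Thm 3.1 (3.42) p.397] -/
theorem gradRow_RS_GprimeP_of_hPcol (ha : 0 ≤ a) (U₀ : GaugeField (F.P K) 0 (Matrix.specialUnitaryGroup (Fin 2) ℂ)) {p139 : ℝ}
    (hPcol : ∀ (bd : PBond (F.P K) 0) (E : Matrix (Fin 2) (Fin 2) ℂ),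
      ∑ x : Site (F.P K) 0, ‖(toL2S F K c₀).symm (GprimeP F n K h c₀ cB a U₀ (RS F n K h c₀ cB U₀ (DstarL2 F n K c₀ U₀ (toL2 F K c₀ (Pi.single bd E))))) x‖ ≤ p139 * ‖E‖) :
    ∀ (v : Site (F.P K) 0 → Matrix (Fin 2) (Fin 2) ℂ) (m : ℝ), (∀ x, ‖v x‖ ≤ m) →
      ∀ b : PBond (F.P K) 0, ‖(toL2 F K c₀).symm (DL2 F n K c₀ U₀ (RS F n K h c₀ cB U₀ (GprimeP F n K h c₀ cB a U₀ (toL2S F K c₀ v)))) b‖ ≤ (8 * p139) * m := by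
  classical
  intro v m hv b
  have hm : 0 ≤ m := (norm_nonneg _).trans (hv (Classical.arbitrary _))
  set A : BondL2K ℂ 3 (periodsT3 F K) c₀ W₂ →ₗ[ℂ] SiteL2K ℂ 3 (periodsT3 F K) c₀ W₂ :=
    GprimeP F n K h c₀ cB a U₀ ∘ₗ RS F n K h c₀ cB U₀ ∘ₗ DstarL2 F n K c₀ U₀ with hA
  have hadj : LinearMap.adjoint A = DL2 F n K c₀ U₀ ∘ₗ RS F n K h c₀ cB U₀ ∘ₗ GprimeP F n K h c₀ cB a U₀ := adjoint_GprimeP_RS_DstarL2 F c₀ h cB a ha U₀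
  -- the torus sup of `g := toL2S v` is `≤ √2·m`
  have hg : ∀ y, ‖WL2.equiv ℂ _ W₂ (toL2S F K c₀ v) y‖ ≤ Real.sqrt 2 * m := fun y => by
    rw [toL2S_apply]; exact (norm_frobEquiv_symm_le _).trans (mul_le_mul_of_nonneg_left (hv _) (Real.sqrt_nonneg _))
  -- §1 at the column bound §2
  have hrow := norm_equiv_adjoint_apply_le_of_column A (column_of_hPcol F h c₀ cB a U₀ hPcol) (toL2S F K c₀ v) (by positivity) hg (bondEquiv F K b)
  rw [hadj] at hrow
  have hcard : (Fintype.card (Fin 2 × Fin 2) : ℝ) = 4 := by norm_num [Fintype.card_prod, Fintype.card_fin]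
  rw [hcard] at hrow
  -- read back on the route bond
  rw [toL2_symm_apply]
  refine (norm_frobEquiv_le _).trans (hrow.trans (le_of_eq ?_))
  have h2 : Real.sqrt 2 * Real.sqrt 2 = 2 := Real.mul_self_sqrt (by norm_num)
  calc (4 : ℝ) * (Real.sqrt 2 * p139 * (Real.sqrt 2 * m)) = 4 * (Real.sqrt 2 * Real.sqrt 2) * p139 * m := by ring
    _ = (8 * p139) * m := by rw [h2]; ring

end Member

section Family

/-! ## §4 ★★★ The family edition: (Dg) for every member, from the landed `hPcol` package -/

/-- ★★★ **(Dg) FOR EVERY MEMBER OF EVERY FAMILY, ∃-PACKAGED, FROM THE LANDED `hPcol` SUPPLIER** (§3 ∘ ✓`Prop7PcolAllMembers.hPcol_allMembers_exists`): there are `αP CDg : ℕ → ℝ` with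
`0 < αP L`, `0 ≤ CDg L` such that for every odd `L > 1`, every member `i : Idx L`, every `0 ≤ a′`, every `U₀ ∈ RegPr (αP L)` satisfying the face's Lift antecedent,
`∀ v m, (∀ x, ‖v x‖ ≤ m) → ∀ b, ‖toL2⁻¹(D_{U₀}(R_S(G′ᴾ_{a′}(toL2S v)))) b‖ ≤ CDg L·m` (`CDg L := 8·pP L`). [cite: Balaban1985Variational, (138)–(139) p.299; Balaban1985BackgroundPropagators, Thm 3.1 (3.42) p.397, (3.49) p.399] -/
theorem gradRow_RS_GprimeP_allMembers_exists (c₀ cB : ℕ → ℝ) [hc₀ : ∀ L : ℕ, Fact (0 < c₀ L)] [hcB : ∀ L : ℕ, Fact (0 < cB L)] :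
    ∃ (αP CDg : ℕ → ℝ), (∀ L : ℕ, 1 < L → 0 < αP L) ∧ (∀ L : ℕ, 1 < L → 0 ≤ CDg L) ∧
      ∀ (L : ℕ), 1 < L → ∀ (i : T3Thm1Carrier.Idx L) (a' : ℝ), 0 ≤ a' → ∀ (U₀ : GaugeField (i.1.1.P i.1.2.2) 0 (Matrix.specialUnitaryGroup (Fin 2) ℂ)), RegPr i.1.1 i.1.2.1 i.1.2.2 (αP L) U₀ →
      (∀ cf : Site (i.1.1.P i.1.2.2) (i.1.2.2 - i.1.2.1) → Matrix (Fin 2) (Fin 2) ℂ,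
      (∀ e' : PBond (i.1.1.P i.1.2.2) (i.1.2.2 - i.1.2.1), cf e'.src = ((emlIterU (i.1.2.2 - i.1.2.1) (bgUnits i.1.1 i.1.2.2 U₀) e' : (Matrix (Fin 2) (Fin 2) ℂ)ˣ) : Matrix (Fin 2) (Fin 2) ℂ) * cf e'.tgt *
      (((emlIterU (i.1.2.2 - i.1.2.1) (bgUnits i.1.1 i.1.2.2 U₀) e')⁻¹ : (Matrix (Fin 2) (Fin 2) ℂ)ˣ) : Matrix (Fin 2) (Fin 2) ℂ)) →
      ∃ l₀ : Site (i.1.1.P i.1.2.2) 0 → Matrix (Fin 2) (Fin 2) ℂ,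
      (∀ b' : PBond (i.1.1.P i.1.2.2) 0, l₀ b'.src = ((bgUnits i.1.1 i.1.2.2 U₀ b' : (Matrix (Fin 2) (Fin 2) ℂ)ˣ) : Matrix (Fin 2) (Fin 2) ℂ) * l₀ b'.tgt * (((bgUnits i.1.1 i.1.2.2 U₀ b')⁻¹ : (Matrix (Fin 2) (Fin 2) ℂ)ˣ) : Matrix (Fin 2) (Fin 2) ℂ)) ∧
      ∀ y : Site (i.1.1.P i.1.2.2) (i.1.2.2 - i.1.2.1), l₀ (embIter (i.1.2.2 - i.1.2.1) y) = cf y) →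
      ∀ (v : Site (i.1.1.P i.1.2.2) 0 → Matrix (Fin 2) (Fin 2) ℂ) (m : ℝ), (∀ x, ‖v x‖ ≤ m) →
      ∀ b : PBond (i.1.1.P i.1.2.2) 0, ‖(toL2 i.1.1 i.1.2.2 (c₀ L)).symm (DL2 i.1.1 i.1.2.1 i.1.2.2 (c₀ L) U₀ (RS i.1.1 i.1.2.1 i.1.2.2 i.2.2.le (c₀ L) (cB L) U₀
        (GprimeP i.1.1 i.1.2.1 i.1.2.2 i.2.2.le (c₀ L) (cB L) a' U₀ (toL2S i.1.1 i.1.2.2 (c₀ L) v)))) b‖ ≤ CDg L * m := by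
  obtain ⟨αP, pP, hα, hp, H⟩ := hPcol_allMembers_exists c₀ cB
  refine ⟨αP, fun L => 8 * pP L, hα, fun L hL => by have := hp L hL; positivity, ?_⟩
  intro L hL i a' ha' U₀ hreg hLift
  exact gradRow_RS_GprimeP_of_hPcol i.1.1 i.2.2.le (c₀ L) (cB L) a' ha' U₀ (H L hL i a' ha' U₀ hreg hLift)

end Family

end Summit.QuantumFields.YangMills.Theorems.Prop7GradientRowOfPcol

end
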